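import Summits.ResolutionOfSingularities.ResolutionOfSingularities.Theorems.EquisingularLiftEquisingularLiftNatTowerConeRoundOld
import Summits.ResolutionOfSingularities.ResolutionOfSingularities.Theorems.EquisingularLiftEquisingularLiftNatTowerExceptionalDense
import Summits.ResolutionOfSingularities.ResolutionOfSingularities.Theorems.EquisingularLiftEquisingularLiftNatTowerRuledRoots
import HarnessLib

/-!
# [OURS · L1 W4.5(b) · EL♮(3)] HSUB′(ReachTower₃) — THE ČECH-WITNESSED ROUND ON `Tower.Inv₂`, OLD EXCEPTIONAL SURFACE `E ↦ closure υ₂⁻¹(E ∖ Z)`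
# (tower driver clause (round), Čech disjunct of `TowerRound₂`, second conclusion; the assembly's stand-in S6 `hCech`, second half; sequel of
# …NatTowerCechRound)

res-D-pv-057 g9 AS a w45b hand (res-L1-w45b-plan-1 NAMING 2026-08-27T20:19:01Z; S6 STATEMENT OF RECORD 20:21:03Z (2) = res-D-pv-029's `hCech` binder).
OURS; NOT a statement of any manuscript; AI-written, weaker than expert review. No `sorry`; standard axioms. DEF-FREE.
`--supports stmt-ResolutionOfSingularities-20148 --as helper`. Pattern (E): NAMED STAND-INS shrink as bricks land.

WHAT. `Tower.inv₂_cechRound_old`: in the setting of `Tower.inv₂_cechRound_new` (a Čech-witnessed round along a section `Z ⊆ E ∩ T` at a tower stage with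
`Tower.Inv₂ … (DirLift.Ruled …) …`), the TRANSPORTED OLD surface: `Tower.Inv₂` at `(G′, υ₂ ≫ γ, closure υ₂⁻¹(T ∖ Z), closure υ₂⁻¹(E ∖ Z), K′)` for the
forgotten shadow `K′ = ∅` and, OFF THE SHADOW, for `K′ = closure υ₂⁻¹(K ∖ Z)`, modulo the named stand-ins (N1) `hCentre` (the Čech centre `𝒞 = 𝓔 ⊔ 𝒦₁`, as in
the first half) and (N3′) `hShadowOld` (the (k-ii)–(k-vi) clauses of `Tower.Shadow₂` for the pair `(St_𝒞 𝓔, St_𝒞 𝒦)` after a Čech round off the shadow —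
unlike the cone round, the two strict transforms are NOT disjoint in general; owner 051 / stub-2).
HOW. res-D-pv-029's `Tower.inv₂_coneRound_old` VERBATIM with the cone partner replaced by `𝒦₁`: `𝓔″ := St_𝒞 𝓔`; (e-i) res-D-pv-051 `coneRound_exceptional_comap`
(its Cartier hypothesis is (c4) «the centre is a Cartier divisor on `V(𝓔)`»), the density `E ⊆ closure (E ∖ Z)` DISCHARGED by stub-2's
`subset_closure_diff_of_flat_of_isEffectiveCartier` (p564222) from (c1)/(c2)/(c4); (e-ii) `isPrincipal_stalkIdeal_strictTransformIdeal`; (e-iii) along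
`exists_iso_subscheme_strictTransformIdeal_exceptional`; (e-iv) `St 𝓔 ≥ 𝓔·𝒪`; (e-v) DISCHARGED by stub-2's `DirLift.ruled_comp` along that isomorphism.
-/

set_option linter.dupNamespace false -- mandated namespace `Summit.<Summit>.<Problem>` of this single-conjunct summit
set_option linter.overlappingInstances false -- signatures carry `[IsDomain O] [IsDiscreteValuationRing O]`

noncomputable section

open CategoryTheory CategoryTheory.Limits AlgebraicGeometry TopologicalSpace Topology IsLocalRing
open Literature.AlgebraicGeometry.Resolution
open Literature.AlgebraicGeometry.Morphisms (ProjCech.PP ProjCech.toSpec)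
open AlgebraicGeometry.Scheme.IdealSheafData
open Summit.ResolutionOfSingularities.ResolutionOfSingularities.Theses.EquisingularLift.Split
open Summit.ResolutionOfSingularities.ResolutionOfSingularities.Cruxes.EquisingularLift.StrataSplit

namespace Summit.ResolutionOfSingularities.ResolutionOfSingularities.Cruxes.EquisingularLiftNat.Sections

set_option maxHeartbeats 800000 in -- one large refine over a 20-clause invariant
/-- **THE ČECH-WITNESSED ROUND on `Tower.Inv₂` (at `Ruled := DirLift.Ruled`), transported OLD exceptional surface** (see the module docstring for the
named stand-ins (N1) `hCentre`, (N3′) `hShadowOld`). [cite: GortzWedhorn2020, (13.19) and Prop. 13.91] [cite: Liu2002, Thm. 8.1.19] [cite: Matsumura1987, §16]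
[OURS · L1 W4.5b] clause (round) of the tower driver toward `stub_elnat_coneTowerPointResolution` (stmt-ResolutionOfSingularities-20148 / -20038); NOT a
statement of the manuscript. -/
theorem Tower.inv₂_cechRound_old (O : Type) [CommRing O] [IsDomain O] [IsDiscreteValuationRing O] (k : Type) [Field k]
    (θ : O →+* k) (hθ : Function.Surjective θ)
    (P : Scheme.{0}) (q : P ⟶ Spec (.of O)) [IsProper q] (Y : Set P) (hYirr : IsIrreducible Y) (hYcl : IsClosed Y)
    (hPnoeth : IsLocallyNoetherian P) (hPreg : Scheme.IsRegular P)
    (Ch : ∀ X' : Scheme.{0}, (X' ⟶ P) → Set X' → Prop)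
    (hChain : ∀ (X' : Scheme.{0}) (σ : X' ⟶ P) (S : Set X'), Ch X' σ S → Chain P Y X' σ S)
    (hStep : ∀ (X' X'' : Scheme.{0}) (σ' : X' ⟶ P) (S' : Set X') (C : X'.IdealSheafData) (τ : X'' ⟶ X'),
      Ch X' σ' S' → IsBlowup τ C → Scheme.IsRegular C.subscheme → Flat (C.subschemeι ≫ σ' ≫ q) →
      σ' '' (C.support : Set X') ⊆ {x : P | ¬ IsGenericPoint x Y} →
      (C.support : Set X') ∩ (σ' ≫ q) ⁻¹' {IsLocalRing.closedPoint O} ⊆ S' →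
      Ch X'' (τ ≫ σ') (closure (τ ⁻¹' (S' \ (C.support : Set X')))))
    {F₉ : Scheme.{0}} (Z₉ : Set F₉) (hZ₉ : IsClosed Z₉) {F₁₀ : Scheme.{0}} (υ' : F₁₀ ⟶ F₉)
    (G G' : Scheme.{0}) (γ : G ⟶ F₁₀) (T E K : Set G) (hE : IsClosed E) (Z : Set G) (hZ : IsClosed Z) (υ₂ : G' ⟶ G)
    (hinv : Tower.Inv₂ O k θ P q Y Ch (DirLift.Ruled O k θ P q Y) F₉ Z₉ hZ₉ F₁₀ υ' G γ T E K)
    (hZET : Z ⊆ E ∩ T) (hfull : TowerFull F₉ F₁₀ υ' Z₉ hZ₉ G γ Z hZ)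
    (hυ₂ : IsBlowup υ₂ (vanishingIdeal ⟨Z, hZ⟩))
    -- the assembly's downstairs side facts carried next to `Tower.Inv₂`
    (hKcl : IsClosed K) (hKE : K ⊆ closure (K \ E)) (hKne : K ≠ Set.univ)
    -- (N1) STAND-IN: the ČECH CENTRE `𝒞 = 𝓔 ⊔ 𝒦₁` at this stage (as in …NatTowerCechRound; (c5)/(c6) are not needed by the old surface)
    (hCentre : ∀ (X : Scheme.{0}) (σ : X ⟶ P) (S : Set X) (jG : G ⟶ X) (tG : G ⟶ Spec (.of k)) (𝓔 : X.IdealSheafData),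
        Ch X σ S → IsIntegral X → IsLocallyNoetherian X → Scheme.IsRegular X → IsDominant (σ ≫ q) →
        IsPullback jG tG (σ ≫ q) (Spec.map (CommRingCat.ofHom θ)) → jG '' T = S →
        𝓔.comap jG = vanishingIdeal ⟨E, hE⟩ → (∀ z : X, (stalkIdeal 𝓔 z).IsPrincipal) → Scheme.IsRegular 𝓔.subscheme →
        σ '' (𝓔.support : Set X) ⊆ {p : P | ¬ IsGenericPoint p Y} →
        DirLift.Ruled O k θ P q Y F₉ Z₉ hZ₉ F₁₀ υ' G γ E X σ jG 𝓔 →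
        ∃ 𝒦₁ : X.IdealSheafData,
          (𝓔 ⊔ 𝒦₁).comap jG = vanishingIdeal ⟨Z, hZ⟩ ∧ Flat ((𝓔 ⊔ 𝒦₁).subschemeι ≫ σ ≫ q) ∧
          Scheme.IsRegular (𝓔 ⊔ 𝒦₁).subscheme ∧ IsEffectiveCartier (𝒦₁.comap 𝓔.subschemeι) ∧
          (∀ x ∈ (𝓔 ⊔ 𝒦₁).support, ∃ c : Fin 2 → X.presheaf.stalk x,
            Ideal.span (Set.range c) = stalkIdeal (𝓔 ⊔ 𝒦₁) x ∧ IsQuasiRegular c) ∧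
          (RationalCarrier (redSub F₉ Z₉ hZ₉) →
            ∃ e₁ : (𝓔 ⊔ 𝒦₁).subscheme ≅ ProjCech.PP O 1, e₁.hom ≫ ProjCech.toSpec O 1 = (𝓔 ⊔ 𝒦₁).subschemeι ≫ σ ≫ q))
    -- (N3′) STAND-IN: the transported shadow next to the OLD surface after a Čech round OFF the shadow (owner res-D-pv-051 / res-L1-w45b-stub-2)
    (hShadowOld : ∀ (X : Scheme.{0}) (σ : X ⟶ P) (S : Set X) (jG : G ⟶ X) (tG : G ⟶ Spec (.of k)) (𝓔 𝒦 𝒦₁ : X.IdealSheafData)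
        (X₂ : Scheme.{0}) (τ : X₂ ⟶ X) (j₂ : G' ⟶ X₂) (t₂ : G' ⟶ Spec (.of k)),
        Ch X σ S → IsIntegral X → IsLocallyNoetherian X → Scheme.IsRegular X → IsDominant (σ ≫ q) →
        IsPullback jG tG (σ ≫ q) (Spec.map (CommRingCat.ofHom θ)) → jG '' T = S →
        𝓔.comap jG = vanishingIdeal ⟨E, hE⟩ → (∀ z : X, (stalkIdeal 𝓔 z).IsPrincipal) → Scheme.IsRegular 𝓔.subscheme →
        (∀ z : X, (stalkIdeal 𝒦 z).IsPrincipal) → 𝒦.comap jG = vanishingIdeal (⟨closure K, isClosed_closure⟩ : Closeds G) →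
        Flat ((𝓔 ⊔ 𝒦).subschemeι ≫ σ ≫ q) → IsEffectiveCartier (𝓔.comap 𝒦.subschemeι) → IsEffectiveCartier (𝒦.comap 𝓔.subschemeι) →
        (𝓔 ⊔ 𝒦₁).comap jG = vanishingIdeal ⟨Z, hZ⟩ → Flat ((𝓔 ⊔ 𝒦₁).subschemeι ≫ σ ≫ q) → Scheme.IsRegular (𝓔 ⊔ 𝒦₁).subscheme →
        IsEffectiveCartier (𝒦₁.comap 𝓔.subschemeι) →
        IsBlowup τ (𝓔 ⊔ 𝒦₁) → IsPullback j₂ t₂ ((τ ≫ σ) ≫ q) (Spec.map (CommRingCat.ofHom θ)) → j₂ ≫ τ = υ₂ ≫ jG →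
        IsClosed K → K ⊆ closure (K \ E) → K ≠ Set.univ → closure (Z \ closure K) = Z →
        (strictTransformIdeal τ (𝓔 ⊔ 𝒦₁) 𝒦).comap j₂ =
            vanishingIdeal (⟨closure (closure (υ₂ ⁻¹' (K \ Z))), isClosed_closure⟩ : Closeds G') ∧
          Flat ((strictTransformIdeal τ (𝓔 ⊔ 𝒦₁) 𝓔 ⊔ strictTransformIdeal τ (𝓔 ⊔ 𝒦₁) 𝒦).subschemeι ≫ (τ ≫ σ) ≫ q) ∧
          (∀ (E' : Set G') (hE' : IsClosed E') (K'' : Set G') (y : G'),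
            j₂ y ∈ ((strictTransformIdeal τ (𝓔 ⊔ 𝒦₁) 𝓔 ⊔ strictTransformIdeal τ (𝓔 ⊔ 𝒦₁) 𝒦).support : Set X₂) →
            stalkIdeal (vanishingIdeal (⟨E', hE'⟩ : Closeds G') ⊔
              vanishingIdeal (⟨closure K'', isClosed_closure⟩ : Closeds G')) y =
            stalkIdeal (vanishingIdeal (⟨E' ∩ closure K'', hE'.inter isClosed_closure⟩ : Closeds G')) y →
            IsRegularLocalRing (X₂.presheaf.stalk (j₂ y) ⧸
              stalkIdeal (strictTransformIdeal τ (𝓔 ⊔ 𝒦₁) 𝓔 ⊔ strictTransformIdeal τ (𝓔 ⊔ 𝒦₁) 𝒦) (j₂ y))) ∧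
          IsEffectiveCartier ((strictTransformIdeal τ (𝓔 ⊔ 𝒦₁) 𝓔).comap (strictTransformIdeal τ (𝓔 ⊔ 𝒦₁) 𝒦).subschemeι) ∧
          IsEffectiveCartier ((strictTransformIdeal τ (𝓔 ⊔ 𝒦₁) 𝒦).comap (strictTransformIdeal τ (𝓔 ⊔ 𝒦₁) 𝓔).subschemeι))
    (K' : Set G') (hK' : K' = ∅ ∨ (closure (Z \ closure K) = Z ∧ K' = closure (υ₂ ⁻¹' (K \ Z)))) :
    Tower.Inv₂ O k θ P q Y Ch (DirLift.Ruled O k θ P q Y) F₉ Z₉ hZ₉ F₁₀ υ' G' (υ₂ ≫ γ) (closure (υ₂ ⁻¹' (T \ Z)))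
      (closure (υ₂ ⁻¹' (E \ Z))) K' := by
  classical
  obtain ⟨hυ', hZinf, hGint, hTcl, hTirr, hEcl, hTE₀, X, σ, S, jG, tG, hCh, hXint, hXnoeth, hXreg, hdom, hsq, hTS, hexc⟩ := hinv
  haveI := hGint
  haveI := hXint
  haveI := hXnoeth
  -- the exceptional surface hosts this round, so it is round-ready
  have hZE : Z ⊆ E := fun z hz => (hZET hz).1
  have hZT : Z ⊆ T := fun z hz => (hZET hz).2
  rcases hexc hE with hno | ⟨𝓔, he_i, he_ii, he_iii, he_iv, he_v, hshadow⟩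
  · exact absurd hfull (Tower.not_towerFull_of_noRound υ' Z₉ hZ₉ hZinf G γ E hno Z hZ hZE)
  -- (N1) the Čech centre `𝒞 = 𝓔 ⊔ 𝒦₁`
  obtain ⟨𝒦₁, hc1, hc2, hc3, hc4, -, -⟩ :=
    hCentre X σ S jG tG 𝓔 hCh hXint hXnoeth hXreg hdom hsq hTS he_i he_ii he_iii he_iv he_v
  -- properness of the stage; the model square
  obtain ⟨-, -, hσ⟩ := chain_isRegular P Y X σ S (hChain _ _ _ hCh) hPnoeth hPreg
  haveI := hσ
  haveI : IsProper (σ ≫ q) := inferInstance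
  haveI : IsClosedImmersion (Spec.map (CommRingCat.ofHom θ)) := IsClosedImmersion.spec_of_surjective _ hθ
  haveI hjci : IsClosedImmersion jG := MorphismProperty.IsStableUnderBaseChange.of_isPullback hsq.flip inferInstance
  -- the centre is off the generic point of `Y` (it lies on `V(𝓔)`)
  have hiv : σ '' ((𝓔 ⊔ 𝒦₁).support : Set X) ⊆ {p : P | ¬ IsGenericPoint p Y} := by
    rintro _ ⟨x, hx, rfl⟩
    exact he_iv ⟨x, Scheme.IdealSheafData.support_antitone le_sup_left hx, rfl⟩
  -- support bookkeeping downstairs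
  have hsuppZ : ((vanishingIdeal ⟨Z, hZ⟩ : G.IdealSheafData).support : Set G) = Z := Scheme.IdealSheafData.coe_support_vanishingIdeal _
  have hDT : ((vanishingIdeal ⟨Z, hZ⟩ : G.IdealSheafData).support : Set G) ⊆ T := by rw [hsuppZ]; exact hZT
  have hTZ : ¬ T ⊆ Z := fun h => hTE₀ (h.trans hZE)
  have hTD : ¬ T ⊆ ((vanishingIdeal ⟨Z, hZ⟩ : G.IdealSheafData).support : Set G) := by rw [hsuppZ]; exact hTZ
  -- blow up the centre and run the model step
  obtain ⟨X₂, τ, hτ⟩ := exists_isBlowup X (𝓔 ⊔ 𝒦₁)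
  obtain ⟨hint₂, hnoeth₂, hreg₂, hdom₂, hF₂, hirr, j₂, t₂, hsq₂, hcomm, hCh₂⟩ :=
    modelStep_chain O k θ hθ P q Y hYirr hYcl Ch hChain hStep X σ S hCh hXreg hdom G jG tG hsq T hTS (𝓔 ⊔ 𝒦₁)
      (vanishingIdeal ⟨Z, hZ⟩) hc1 hc3 hc2 hiv hDT hTD X₂ τ hτ G' υ₂ hυ₂
  rw [hsuppZ] at hirr hCh₂
  haveI := hint₂
  haveI := hnoeth₂
  haveI := hF₂
  haveI : IsProper τ := hτ.isProper
  have hcart : IsPullback j₂ υ₂ τ jG := isPullback_of_model_squares θ hθ (σ ≫ q) τ jG tG hsq j₂ t₂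
    (by simpa only [Category.assoc] using hsq₂) υ₂ hcomm
  -- a point of `G'` off the exceptional surface, `T' ⊄ E''`, the centre is non-zero
  obtain ⟨t, htT, htE⟩ := Set.not_subset.mp hTE₀
  have htZ : t ∉ Z := fun h => htE (hZE h)
  obtain ⟨t', ht'⟩ := hυ₂.exists_preimage_of_not_mem_support (z := t) (by rw [hsuppZ]; exact htZ)
  have hCne : 𝓔 ⊔ 𝒦₁ ≠ ⊥ := by
    rintro hbot
    obtain ⟨u, hu, hKu⟩ := hτ.isEffectiveCartier.exists_stalkIdeal_eq_span (j₂ t')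
    rw [hbot, Scheme.IdealSheafData.comap_bot, stalkIdeal_bot, eq_comm, Ideal.span_singleton_eq_bot] at hKu
    rw [hKu] at hu
    exact zero_notMem_nonZeroDivisors hu
  have hTE'' : ¬ closure (υ₂ ⁻¹' (T \ Z)) ⊆ closure (υ₂ ⁻¹' (E \ Z)) := by
    intro h
    have h1 : t' ∈ closure (υ₂ ⁻¹' (T \ Z)) := subset_closure (show υ₂ t' ∈ T \ Z by rw [ht']; exact ⟨htT, htZ⟩)
    have h2 : t' ∈ υ₂ ⁻¹' E :=
      (closure_minimal (Set.preimage_mono fun x hx => hx.1) (hE.preimage υ₂.continuous)) (h h1)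
    rw [Set.mem_preimage, ht'] at h2
    exact htE h2
  -- the density `E ⊆ closure (E ∖ Z)` (stub-2's engine, p564222) and the transported old surface `𝓔'' := St_𝒞 𝓔`
  have hEZ : E ⊆ closure (E \ Z) :=
    subset_closure_diff_of_flat_of_isEffectiveCartier θ hθ q σ jG tG hsq 𝓔 𝒦₁ hE hZ he_i hc1 hc2 hc4
  have hEc : ((⟨E, hE⟩ : Closeds G) : Set G) ⊆ closure (((⟨E, hE⟩ : Closeds G) : Set G) \ (⟨Z, hZ⟩ : Closeds G)) := hEZ
  have ho1 : (strictTransformIdeal τ (𝓔 ⊔ 𝒦₁) 𝓔).comap j₂ =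
      vanishingIdeal (⟨closure (υ₂ ⁻¹' (E \ Z)), isClosed_closure⟩ : Closeds G') :=
    coneRound_exceptional_comap 𝓔 𝒦₁ hc4 hτ hcart ⟨E, hE⟩ ⟨Z, hZ⟩ he_i hυ₂ hEc
  have ho2 : ∀ z : X₂, (stalkIdeal (strictTransformIdeal τ (𝓔 ⊔ 𝒦₁) 𝓔) z).IsPrincipal := fun z =>
    isPrincipal_stalkIdeal_strictTransformIdeal hXreg hc3 hτ hCne 𝓔 he_ii z
  obtain ⟨e𝓔, he𝓔⟩ := exists_iso_subscheme_strictTransformIdeal_exceptional 𝓔 𝒦₁ hc4 hτ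
  have ho3 : Scheme.IsRegular (strictTransformIdeal τ (𝓔 ⊔ 𝒦₁) 𝓔).subscheme :=
    Scheme.IsRegular.of_isOpenImmersion e𝓔.hom he_iii
  have ho4 : (τ ≫ σ) '' ((strictTransformIdeal τ (𝓔 ⊔ 𝒦₁) 𝓔).support : Set X₂) ⊆ {p : P | ¬ IsGenericPoint p Y} := by
    rintro _ ⟨z, hz, rfl⟩
    have hz' : z ∈ ((𝓔.comap τ).support : Set X₂) :=
      Scheme.IdealSheafData.support_antitone (comap_le_strictTransformIdeal τ (𝓔 ⊔ 𝒦₁) 𝓔) hz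
    rw [Scheme.IdealSheafData.support_comap] at hz'
    exact he_iv ⟨τ z, hz', rfl⟩
  -- (e-v) the ruled-surface datum is TRANSPORTED along `V(St 𝓔) ≅ V(𝓔)` (stub-2's `DirLift.ruled_comp`)
  have ho5 : DirLift.Ruled O k θ P q Y F₉ Z₉ hZ₉ F₁₀ υ' G' (υ₂ ≫ γ) (closure (υ₂ ⁻¹' (E \ Z))) X₂ (τ ≫ σ) j₂
      (strictTransformIdeal τ (𝓔 ⊔ 𝒦₁) 𝓔) :=
    DirLift.ruled_comp he_v τ υ₂ j₂ hcomm (strictTransformIdeal τ (𝓔 ⊔ 𝒦₁) 𝓔) e𝓔 he𝓔 _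
  -- (k-i) for the transported shadow is generic
  have hk1 : ∀ (𝒦 : X.IdealSheafData), (∀ z : X, (stalkIdeal 𝒦 z).IsPrincipal) →
      ∀ z : X₂, (stalkIdeal (strictTransformIdeal τ (𝓔 ⊔ 𝒦₁) 𝒦) z).IsPrincipal := fun 𝒦 h𝒦 z =>
    isPrincipal_stalkIdeal_strictTransformIdeal hXreg hc3 hτ hCne 𝒦 h𝒦 z
  -- assemble
  refine ⟨hυ', hZinf, hF₂, isClosed_closure, hirr, isClosed_closure, hTE'', X₂, τ ≫ σ, _, j₂, t₂, hCh₂, hint₂, hnoeth₂,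
    hreg₂, hdom₂, hsq₂, rfl, fun hE' => Or.inr ⟨strictTransformIdeal τ (𝓔 ⊔ 𝒦₁) 𝓔, ho1, ho2, ho3, ho4, ho5, ?_⟩⟩
  rcases hK' with hK' | ⟨hoff, hK'⟩
  · exact Or.inl hK'
  · subst hK'
    rcases hshadow with hK0 | ⟨𝒦, hk_i, hk_ii, hk_iii, hk_iv, hk_v, hk_vi⟩
    · left
      subst hK0
      simp only [Set.empty_sdiff, Set.preimage_empty, closure_empty]
    · right
      obtain ⟨hs2, hs3, hs4, hs5, hs6⟩ := hShadowOld X σ S jG tG 𝓔 𝒦 𝒦₁ X₂ τ j₂ t₂ hCh hXint hXnoeth hXreg hdom hsq hTS he_i he_ii he_iii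
        hk_i hk_ii hk_iii hk_v hk_vi hc1 hc2 hc3 hc4 hτ hsq₂ hcomm hKcl hKE hKne hoff
      exact ⟨_, hk1 𝒦 hk_i, hs2, hs3, hs4 _ _ _, hs5, hs6⟩

end Summit.ResolutionOfSingularities.ResolutionOfSingularities.Cruxes.EquisingularLiftNat.Sections

end
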